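import Summits.CriticalPhenomena.PercolationContinuityZ3.Theorems.PercNearOneGluingNoHeavyLowerTailSahiC3CubeThreeFKGPrelim

/-!
# `NoHeavyLowerTail` (crux stmt-CriticalPhenomena-4575), Sahi programme P1: Sahi's conjecture `C₃` holds on the Boolean lattice
# `{0,1}³` for EVERY FKG (log-supermodular) measure

Support file (Sahi cell, seat `prim-sahi-p1`; `--supports stmt-CriticalPhenomena-4575`).  New mathematics (not in print): Sahi
[Combinatorica 28 (2008), Prop. 15] proves his Conjecture 5 on `2^X` for `|X| ≤ 2`; for `|X| ≥ 3` only special classes are known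
(one principal slot — Sahi Thm 2 / Blinovsky, tree `latticeE3_nonneg_of_principal`; nested pairs; Lieb–Sahi's rectangles; the
conjecture is open in general even for product measures, Kahn 2022).

**Theorem `latticeE3_nonneg_cube_three`.**  For every weight `μ ≥ 0` on `{0,1}³ = (Fin 3 → Bool)` with
`μ a · μ b ≤ μ (a ⊓ b) · μ (a ⊔ b)` and all up-sets `A, B, C`:  `0 ≤ latticeE3 μ A B C`
(`= Z³·E₃(1_A,1_B,1_C)` for the normalised measure; `Literature.Probability.LatticeModels.latticeE3`).

Proof.  `E₃` is symmetric; sort the triple by the code `encF`.  The finite check `cls3_all` (`decide` over the `20` increasing codes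
`upsN 3`) shows that every sorted triple of up-sets has an empty slot (`latticeE3_empty`), a full slot (`latticeE3_univ_nonneg`), a
principal slot (`latticeE3_nonneg_of_principal`), a nested pair (`latticeE3_nonneg_of_subset`), or is one of THREE `S₃`-symmetric
triples, settled here by explicit degree-3 certificates in the cone of the `2 × 2` FKG minors (`a,b,c` the coordinates; point codes
`0 = ∅, 1 = a, 2 = b, 3 = ab, 4 = c, 5 = ac, 6 = bc, 7 = abc`; `μⱼ` the weight of point `j`, `Z = Σ μⱼ`):
* `T_A = {a∨bc, b∨ac, c∨ab}` (codes `234, 236, 248`; `hardA_nonneg`): pairwise intersections = triple intersection = `maj`, and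
  `E₃ = M(μ₀+σ₁)(Z+μ₀) + Mσ₂ + σ₃` (`M = μ₃+μ₅+μ₆+μ₇`, `σₖ` elementary symmetric in `μ₁,μ₂,μ₄`) — nonnegative for EVERY weight;
* `T_B = {a(b∨c), b(a∨c), c(a∨b)}` (codes `168, 200, 224`; `hardB_nonneg`): with `W = μ₃+μ₅+μ₆+μ₇`,
  `E₃ = μ₀μ₇(2Z−W−μ₇) + (2Z−W)(s₁+s₂+s₃) + μ₃s₁ + μ₇s₄`, minor slacks `s₁ = μ₄μ₇−μ₅μ₆`, `s₂ = μ₁μ₇−μ₃μ₅`, `s₃ = μ₂μ₇−μ₃μ₆`,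
  `s₄ = μ₀μ₇−μ₃μ₄`;
* `T_C = {a∨b, a∨c, b∨c}` (codes `238, 250, 252`; `hardC_nonneg`): `E₃ = Zμ₀μ₇ + (Z+μ₀)(t₁+t₂+t₃) + μ₀t₄ + μ₄t₁`, slacks
  `t₁ = μ₀μ₃−μ₁μ₂`, `t₂ = μ₀μ₅−μ₁μ₄`, `t₃ = μ₀μ₆−μ₂μ₄`, `t₄ = μ₀μ₇−μ₃μ₄`; in particular `E₃(T_C) ≥ Z·μ(∅)·μ(abc)`, an identity for
  product measures.
By trilinearity the inequality extends to nonnegative monotone functions, and by zero-extension of the weight to every FKG measure on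
a distributive lattice with at most three join-irreducibles.  Discovery numerics (seat folder py/): 2 300 random log-supermodular
measures × all 1 540 triples, 0 negatives; the three identities verified in exact arithmetic (py/check_hom.py).
-/

namespace Summit.CriticalPhenomena.PercolationContinuityZ3.Theorems.SahiC3Cube

open Finset OneCutCert Literature.Probability.LatticeModels
open scoped BigOperators

/-- Pointwise order on the cube is decidable. [folklore] -/
instance decLECube3 : DecidableLE (Fin 3 → Bool) := fun f g => inferInstanceAs (Decidable (∀ i, f i ≤ g i))

section Hard

variable {μ : (Fin 3 → Bool) → ℝ}

/-- An FKG minor between two coded points of the `3`-cube. [this work] -/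
theorem minor3 (hμ : ∀ a b, μ a * μ b ≤ μ (a ⊓ b) * μ (a ⊔ b)) (i j k l : ℕ) (hk : ptB 3 i ⊓ ptB 3 j = ptB 3 k)
    (hl : ptB 3 i ⊔ ptB 3 j = ptB 3 l) : μ (ptB 3 i) * μ (ptB 3 j) ≤ μ (ptB 3 k) * μ (ptB 3 l) := by
  rw [← hk, ← hl]; exact hμ _ _

/-- Masses of a coded set and of coded intersections, and the total mass, on the `3`-cube. [this work] -/
theorem mass3_of_code {A : Finset (Fin 3 → Bool)} {a : ℕ} (h : encF 3 A = a) : mass μ A = massL 3 μ (bitsL 8 a) := by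
  rw [mass_eq_massL, h]; rfl

/-- Total mass of the `3`-cube. [this work] -/
theorem mass3_univ : mass μ (univ : Finset (Fin 3 → Bool)) = massL 3 μ [0, 1, 2, 3, 4, 5, 6, 7] := by
  rw [mass_eq_massL, encF_univ]; rfl

/-- Evaluation of the bit lists of the codes met below (kernel computation). [this work] -/
theorem bitsL_eval :
    bitsL 8 234 = [1, 3, 5, 6, 7] ∧ bitsL 8 236 = [2, 3, 5, 6, 7] ∧ bitsL 8 248 = [3, 4, 5, 6, 7] ∧ bitsL 8 232 = [3, 5, 6, 7] ∧
    bitsL 8 168 = [3, 5, 7] ∧ bitsL 8 200 = [3, 6, 7] ∧ bitsL 8 224 = [5, 6, 7] ∧ bitsL 8 136 = [3, 7] ∧ bitsL 8 160 = [5, 7] ∧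
    bitsL 8 192 = [6, 7] ∧ bitsL 8 128 = [7] ∧ bitsL 8 238 = [1, 2, 3, 5, 6, 7] ∧ bitsL 8 250 = [1, 3, 4, 5, 6, 7] ∧
    bitsL 8 252 = [2, 3, 4, 5, 6, 7] := by
  decide

set_option hygiene false in
/-- `w j` = the weight of the point with code `j` (local notation). -/
local notation "w" j:max => μ (ptB 3 j)

/-- **`T_A = {a∨bc, b∨ac, c∨ab}`** (codes `234, 236, 248`): `E₃ = M(μ₀+σ₁)(Z+μ₀) + Mσ₂ + σ₃ ≥ 0` for EVERY nonnegative weight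
(the triple is a sunflower with core `maj`). [this work] -/
theorem hardA_nonneg (hμ₀ : 0 ≤ μ) {A B C : Finset (Fin 3 → Bool)} (hA : encF 3 A = 234) (hB : encF 3 B = 236)
    (hC : encF 3 C = 248) : 0 ≤ latticeE3 μ A B C := by
  have hAB : encF 3 (A ∩ B) = 232 := by rw [encF_inter, hA, hB]; decide
  have hAC : encF 3 (A ∩ C) = 232 := by rw [encF_inter, hA, hC]; decide
  have hBC : encF 3 (B ∩ C) = 232 := by rw [encF_inter, hB, hC]; decide
  have hABC : encF 3 (A ∩ B ∩ C) = 232 := by rw [encF_inter, hAB, hC]; decide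
  obtain ⟨b234, b236, b248, b232, -, -, -, -, -, -, -, -, -, -⟩ := bitsL_eval
  have key : latticeE3 μ A B C =
      (w 3 + w 5 + w 6 + w 7) * (w 0 + (w 1 + w 2 + w 4)) * ((w 0 + w 1 + w 2 + w 3 + w 4 + w 5 + w 6 + w 7) + w 0) +
        (w 3 + w 5 + w 6 + w 7) * (w 1 * w 2 + w 1 * w 4 + w 2 * w 4) + w 1 * w 2 * w 4 := by
    unfold latticeE3
    rw [mass3_of_code hA, mass3_of_code hB, mass3_of_code hC, mass3_of_code hAB, mass3_of_code hAC, mass3_of_code hBC,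
      mass3_of_code hABC, mass3_univ, b234, b236, b248, b232]
    simp only [massL, List.map, List.sum_cons, List.sum_nil, add_zero]
    ring
  rw [key]
  have e0 : (0:ℝ) ≤ μ (ptB 3 0) := hμ₀ _; have e1 : (0:ℝ) ≤ μ (ptB 3 1) := hμ₀ _
  have e2 : (0:ℝ) ≤ μ (ptB 3 2) := hμ₀ _; have e3 : (0:ℝ) ≤ μ (ptB 3 3) := hμ₀ _
  have e4 : (0:ℝ) ≤ μ (ptB 3 4) := hμ₀ _; have e5 : (0:ℝ) ≤ μ (ptB 3 5) := hμ₀ _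
  have e6 : (0:ℝ) ≤ μ (ptB 3 6) := hμ₀ _; have e7 : (0:ℝ) ≤ μ (ptB 3 7) := hμ₀ _
  positivity

/-- **`T_B = {a(b∨c), b(a∨c), c(a∨b)}`** (codes `168, 200, 224`): `E₃ ≥ 0` under a log-supermodular weight, by the identity
`E₃ = μ₀μ₇(2Z−W−μ₇) + (2Z−W)(s₁+s₂+s₃) + μ₃s₁ + μ₇s₄` and four FKG minors. [this work] -/
theorem hardB_nonneg (hμ₀ : 0 ≤ μ) (hμ : ∀ a b, μ a * μ b ≤ μ (a ⊓ b) * μ (a ⊔ b)) {A B C : Finset (Fin 3 → Bool)}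
    (hA : encF 3 A = 168) (hB : encF 3 B = 200) (hC : encF 3 C = 224) : 0 ≤ latticeE3 μ A B C := by
  have hAB : encF 3 (A ∩ B) = 136 := by rw [encF_inter, hA, hB]; decide
  have hAC : encF 3 (A ∩ C) = 160 := by rw [encF_inter, hA, hC]; decide
  have hBC : encF 3 (B ∩ C) = 192 := by rw [encF_inter, hB, hC]; decide
  have hABC : encF 3 (A ∩ B ∩ C) = 128 := by rw [encF_inter, hAB, hC]; decide
  obtain ⟨-, -, -, -, b168, b200, b224, b136, b160, b192, b128, -, -, -⟩ := bitsL_eval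
  have key : latticeE3 μ A B C =
      w 0 * w 7 * (2 * (w 0 + w 1 + w 2 + w 3 + w 4 + w 5 + w 6 + w 7) - (w 3 + w 5 + w 6 + w 7) - w 7) +
        (2 * (w 0 + w 1 + w 2 + w 3 + w 4 + w 5 + w 6 + w 7) - (w 3 + w 5 + w 6 + w 7)) *
          ((w 4 * w 7 - w 6 * w 5) + (w 1 * w 7 - w 5 * w 3) + (w 2 * w 7 - w 3 * w 6)) +
        w 3 * (w 4 * w 7 - w 6 * w 5) + w 7 * (w 0 * w 7 - w 4 * w 3) := by
    unfold latticeE3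
    rw [mass3_of_code hA, mass3_of_code hB, mass3_of_code hC, mass3_of_code hAB, mass3_of_code hAC, mass3_of_code hBC,
      mass3_of_code hABC, mass3_univ, b168, b200, b224, b136, b160, b192, b128]
    simp only [massL, List.map, List.sum_cons, List.sum_nil, add_zero]
    ring
  rw [key]
  have e0 : (0:ℝ) ≤ μ (ptB 3 0) := hμ₀ _; have e1 : (0:ℝ) ≤ μ (ptB 3 1) := hμ₀ _
  have e2 : (0:ℝ) ≤ μ (ptB 3 2) := hμ₀ _; have e3 : (0:ℝ) ≤ μ (ptB 3 3) := hμ₀ _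
  have e4 : (0:ℝ) ≤ μ (ptB 3 4) := hμ₀ _; have e5 : (0:ℝ) ≤ μ (ptB 3 5) := hμ₀ _
  have e6 : (0:ℝ) ≤ μ (ptB 3 6) := hμ₀ _; have e7 : (0:ℝ) ≤ μ (ptB 3 7) := hμ₀ _
  -- the four minors: `μ₆μ₅ ≤ μ₄μ₇`, `μ₅μ₃ ≤ μ₁μ₇`, `μ₃μ₆ ≤ μ₂μ₇`, `μ₄μ₃ ≤ μ₀μ₇`
  have s1 := minor3 hμ 6 5 4 7 (by decide) (by decide)
  have s2 := minor3 hμ 5 3 1 7 (by decide) (by decide)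
  have s3 := minor3 hμ 3 6 2 7 (by decide) (by decide)
  have s4 := minor3 hμ 4 3 0 7 (by decide) (by decide)
  have u1 : 0 ≤ 2 * (w 0 + w 1 + w 2 + w 3 + w 4 + w 5 + w 6 + w 7) - (w 3 + w 5 + w 6 + w 7) - w 7 := by linarith
  have u2 : 0 ≤ 2 * (w 0 + w 1 + w 2 + w 3 + w 4 + w 5 + w 6 + w 7) - (w 3 + w 5 + w 6 + w 7) := by linarith
  have p1 := mul_nonneg (mul_nonneg e0 e7) u1
  have p2 : 0 ≤ (2 * (w 0 + w 1 + w 2 + w 3 + w 4 + w 5 + w 6 + w 7) - (w 3 + w 5 + w 6 + w 7)) *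
      ((w 4 * w 7 - w 6 * w 5) + (w 1 * w 7 - w 5 * w 3) + (w 2 * w 7 - w 3 * w 6)) := mul_nonneg u2 (by linarith)
  have p3 : 0 ≤ w 3 * (w 4 * w 7 - w 6 * w 5) := mul_nonneg e3 (by linarith)
  have p4 : 0 ≤ w 7 * (w 0 * w 7 - w 4 * w 3) := mul_nonneg e7 (by linarith)
  linarith

/-- **`T_C = {a∨b, a∨c, b∨c}`** (codes `238, 250, 252`): `E₃ = Zμ₀μ₇ + (Z+μ₀)(t₁+t₂+t₃) + μ₀t₄ + μ₄t₁ ≥ Z·μ(∅)·μ(abc) ≥ 0` under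
a log-supermodular weight, by four FKG minors (an identity `E₃ = Z·μ(∅)·μ(abc)` for product measures). [this work] -/
theorem hardC_nonneg (hμ₀ : 0 ≤ μ) (hμ : ∀ a b, μ a * μ b ≤ μ (a ⊓ b) * μ (a ⊔ b)) {A B C : Finset (Fin 3 → Bool)}
    (hA : encF 3 A = 238) (hB : encF 3 B = 250) (hC : encF 3 C = 252) : 0 ≤ latticeE3 μ A B C := by
  have hAB : encF 3 (A ∩ B) = 234 := by rw [encF_inter, hA, hB]; decide
  have hAC : encF 3 (A ∩ C) = 236 := by rw [encF_inter, hA, hC]; decide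
  have hBC : encF 3 (B ∩ C) = 248 := by rw [encF_inter, hB, hC]; decide
  have hABC : encF 3 (A ∩ B ∩ C) = 232 := by rw [encF_inter, hAB, hC]; decide
  obtain ⟨b234, b236, b248, b232, -, -, -, -, -, -, -, b238, b250, b252⟩ := bitsL_eval
  have key : latticeE3 μ A B C =
      (w 0 + w 1 + w 2 + w 3 + w 4 + w 5 + w 6 + w 7) * w 0 * w 7 +
        ((w 0 + w 1 + w 2 + w 3 + w 4 + w 5 + w 6 + w 7) + w 0) *
          ((w 0 * w 3 - w 1 * w 2) + (w 0 * w 5 - w 1 * w 4) + (w 0 * w 6 - w 2 * w 4)) +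
        w 0 * (w 0 * w 7 - w 4 * w 3) + w 4 * (w 0 * w 3 - w 1 * w 2) := by
    unfold latticeE3
    rw [mass3_of_code hA, mass3_of_code hB, mass3_of_code hC, mass3_of_code hAB, mass3_of_code hAC, mass3_of_code hBC,
      mass3_of_code hABC, mass3_univ, b238, b250, b252, b234, b236, b248, b232]
    simp only [massL, List.map, List.sum_cons, List.sum_nil, add_zero]
    ring
  rw [key]
  have e0 : (0:ℝ) ≤ μ (ptB 3 0) := hμ₀ _; have e1 : (0:ℝ) ≤ μ (ptB 3 1) := hμ₀ _
  have e2 : (0:ℝ) ≤ μ (ptB 3 2) := hμ₀ _; have e3 : (0:ℝ) ≤ μ (ptB 3 3) := hμ₀ _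
  have e4 : (0:ℝ) ≤ μ (ptB 3 4) := hμ₀ _; have e5 : (0:ℝ) ≤ μ (ptB 3 5) := hμ₀ _
  have e6 : (0:ℝ) ≤ μ (ptB 3 6) := hμ₀ _; have e7 : (0:ℝ) ≤ μ (ptB 3 7) := hμ₀ _
  -- the four minors: `μ₁μ₂ ≤ μ₀μ₃`, `μ₁μ₄ ≤ μ₀μ₅`, `μ₂μ₄ ≤ μ₀μ₆`, `μ₄μ₃ ≤ μ₀μ₇`
  have s1 := minor3 hμ 1 2 0 3 (by decide) (by decide)
  have s2 := minor3 hμ 1 4 0 5 (by decide) (by decide)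
  have s3 := minor3 hμ 2 4 0 6 (by decide) (by decide)
  have s4 := minor3 hμ 4 3 0 7 (by decide) (by decide)
  have hZ : 0 ≤ w 0 + w 1 + w 2 + w 3 + w 4 + w 5 + w 6 + w 7 := by linarith
  have p1 : 0 ≤ (w 0 + w 1 + w 2 + w 3 + w 4 + w 5 + w 6 + w 7) * w 0 * w 7 := mul_nonneg (mul_nonneg hZ e0) e7
  have p2 : 0 ≤ ((w 0 + w 1 + w 2 + w 3 + w 4 + w 5 + w 6 + w 7) + w 0) *
      ((w 0 * w 3 - w 1 * w 2) + (w 0 * w 5 - w 1 * w 4) + (w 0 * w 6 - w 2 * w 4)) :=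
    mul_nonneg (by linarith) (by linarith)
  have p3 : 0 ≤ w 0 * (w 0 * w 7 - w 4 * w 3) := mul_nonneg e0 (by linarith)
  have p4 : 0 ≤ w 4 * (w 0 * w 3 - w 1 * w 2) := mul_nonneg e4 (by linarith)
  linarith

/-- **Quantitative form for `T_C`**: `latticeE3 ≥ Z · μ(∅) · μ(abc)`. [this work] -/
theorem hardC_lower (hμ₀ : 0 ≤ μ) (hμ : ∀ a b, μ a * μ b ≤ μ (a ⊓ b) * μ (a ⊔ b)) {A B C : Finset (Fin 3 → Bool)}
    (hA : encF 3 A = 238) (hB : encF 3 B = 250) (hC : encF 3 C = 252) :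
    mass μ univ * μ (ptB 3 0) * μ (ptB 3 7) ≤ latticeE3 μ A B C := by
  have hAB : encF 3 (A ∩ B) = 234 := by rw [encF_inter, hA, hB]; decide
  have hAC : encF 3 (A ∩ C) = 236 := by rw [encF_inter, hA, hC]; decide
  have hBC : encF 3 (B ∩ C) = 248 := by rw [encF_inter, hB, hC]; decide
  have hABC : encF 3 (A ∩ B ∩ C) = 232 := by rw [encF_inter, hAB, hC]; decide
  obtain ⟨b234, b236, b248, b232, -, -, -, -, -, -, -, b238, b250, b252⟩ := bitsL_eval
  have key : latticeE3 μ A B C - mass μ univ * w 0 * w 7 =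
      ((w 0 + w 1 + w 2 + w 3 + w 4 + w 5 + w 6 + w 7) + w 0) *
          ((w 0 * w 3 - w 1 * w 2) + (w 0 * w 5 - w 1 * w 4) + (w 0 * w 6 - w 2 * w 4)) +
        w 0 * (w 0 * w 7 - w 4 * w 3) + w 4 * (w 0 * w 3 - w 1 * w 2) := by
    unfold latticeE3
    rw [mass3_of_code hA, mass3_of_code hB, mass3_of_code hC, mass3_of_code hAB, mass3_of_code hAC, mass3_of_code hBC,
      mass3_of_code hABC, mass3_univ, b238, b250, b252, b234, b236, b248, b232]
    simp only [massL, List.map, List.sum_cons, List.sum_nil, add_zero]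
    ring
  have e0 : (0:ℝ) ≤ μ (ptB 3 0) := hμ₀ _; have e1 : (0:ℝ) ≤ μ (ptB 3 1) := hμ₀ _
  have e2 : (0:ℝ) ≤ μ (ptB 3 2) := hμ₀ _; have e3 : (0:ℝ) ≤ μ (ptB 3 3) := hμ₀ _
  have e4 : (0:ℝ) ≤ μ (ptB 3 4) := hμ₀ _; have e5 : (0:ℝ) ≤ μ (ptB 3 5) := hμ₀ _
  have e6 : (0:ℝ) ≤ μ (ptB 3 6) := hμ₀ _; have e7 : (0:ℝ) ≤ μ (ptB 3 7) := hμ₀ _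
  have s1 := minor3 hμ 1 2 0 3 (by decide) (by decide)
  have s2 := minor3 hμ 1 4 0 5 (by decide) (by decide)
  have s3 := minor3 hμ 2 4 0 6 (by decide) (by decide)
  have s4 := minor3 hμ 4 3 0 7 (by decide) (by decide)
  have p2 : 0 ≤ ((w 0 + w 1 + w 2 + w 3 + w 4 + w 5 + w 6 + w 7) + w 0) *
      ((w 0 * w 3 - w 1 * w 2) + (w 0 * w 5 - w 1 * w 4) + (w 0 * w 6 - w 2 * w 4)) :=
    mul_nonneg (by linarith) (by linarith)
  have p3 : 0 ≤ w 0 * (w 0 * w 7 - w 4 * w 3) := mul_nonneg e0 (by linarith)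
  have p4 : 0 ≤ w 4 * (w 0 * w 3 - w 1 * w 2) := mul_nonneg e4 (by linarith)
  linarith

end Hard

/-! ## Classification of the triples of up-sets of `{0,1}³` -/

/-- The code of the principal up-set `↑(ptB 3 x)`. [this work] -/
def coneN3 (x : ℕ) : ℕ := ofBits (fun y => x &&& y == x) 8

/-- "Is the code of a principal up-set of the `3`-cube". [this work] -/
def isPrincipal3 (a : ℕ) : Bool := (List.range 8).any fun x => a == coneN3 x

/-- The three hard sorted triples `T_A, T_B, T_C` (codes). [this work] -/
def hard3 : List (ℕ × ℕ × ℕ) := [(234, 236, 248), (168, 200, 224), (238, 250, 252)]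

/-- The class of a sorted triple of codes: an empty slot, a full slot, a principal slot, a nested pair, or hard. [this work] -/
def cls3 (a b c : ℕ) : Bool :=
  (a == 0 || b == 0 || c == 0) || (a == 255 || b == 255 || c == 255) ||
    (isPrincipal3 a || isPrincipal3 b || isPrincipal3 c) ||
    (a &&& b == a || a &&& c == a || b &&& c == b) || decide ((a, b, c) ∈ hard3)

/-- **The classification** (kernel check over the `20` increasing codes of the `3`-cube). [this work] -/
theorem cls3_all : ∀ a ∈ upsN 3, ∀ b ∈ upsN 3, ∀ c ∈ upsN 3, a ≤ b → b ≤ c → cls3 a b c = true := by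
  decide

/-- The bits of `coneN3 x` are the order relation. [this work] -/
theorem coneN3_bits : ∀ x ∈ List.range 8, ∀ j ∈ List.range 8, (coneN3 x).testBit j = decide (ptB 3 x ≤ ptB 3 j) := by
  decide

/-- A set whose code is `coneN3 x` is the principal up-set of `ptB 3 x`. [this work] -/
theorem eq_principalUp_of_encF {A : Finset (Fin 3 → Bool)} {x : ℕ} (hx : x < 8) (h : encF 3 A = coneN3 x) :
    A = principalUp (ptB 3 x) := by
  ext g
  rw [mem_principalUp, mem_iff_testBit_encF, h,
    coneN3_bits x (List.mem_range.2 hx) (enc2 g) (List.mem_range.2 (enc2_lt g)), ptB_enc2, decide_eq_true_iff]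

/-- From the class of the codes to Sahi's inequality. [this work] -/
theorem latticeE3_nonneg_of_cls3 {μ : (Fin 3 → Bool) → ℝ} (hμ₀ : 0 ≤ μ) (hμ : ∀ a b, μ a * μ b ≤ μ (a ⊓ b) * μ (a ⊔ b))
    {A B C : Finset (Fin 3 → Bool)} (hA : IsUpperSet (A : Set (Fin 3 → Bool))) (hB : IsUpperSet (B : Set (Fin 3 → Bool)))
    (hC : IsUpperSet (C : Set (Fin 3 → Bool))) (h : cls3 (encF 3 A) (encF 3 B) (encF 3 C) = true) :
    0 ≤ latticeE3 μ A B C := by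
  have h255 : (255 : ℕ) = 2 ^ (2 ^ 3) - 1 := by norm_num
  unfold cls3 isPrincipal3 at h
  simp only [Bool.or_eq_true, beq_iff_eq, decide_eq_true_eq, List.any_eq_true, List.mem_range] at h
  rcases h with (((((h0 | h0) | h0) | ((hf | hf) | hf)) | ((⟨x, hx, hp⟩ | ⟨x, hx, hp⟩) | ⟨x, hx, hp⟩)) | ((hn | hn) | hn)) | hh
  · rw [eq_empty_of_encF h0, latticeE3_empty]
  · rw [latticeE3_comm₁₂, eq_empty_of_encF h0, latticeE3_empty]
  · rw [latticeE3_comm₁₃, eq_empty_of_encF h0, latticeE3_empty]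
  · rw [eq_univ_of_encF (hf.trans h255)]; exact latticeE3_univ_nonneg hμ₀ hμ hB hC
  · rw [latticeE3_comm₁₂, eq_univ_of_encF (hf.trans h255)]; exact latticeE3_univ_nonneg hμ₀ hμ hA hC
  · rw [latticeE3_comm₁₃, eq_univ_of_encF (hf.trans h255)]; exact latticeE3_univ_nonneg hμ₀ hμ hB hA
  · rw [latticeE3_comm₁₃, eq_principalUp_of_encF hx hp]; exact latticeE3_nonneg_of_principal hμ₀ hμ hC hB _
  · rw [latticeE3_comm₂₃, eq_principalUp_of_encF hx hp]; exact latticeE3_nonneg_of_principal hμ₀ hμ hA hC _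
  · rw [eq_principalUp_of_encF hx hp]; exact latticeE3_nonneg_of_principal hμ₀ hμ hA hB _
  · exact latticeE3_nonneg_of_subset hμ₀ hμ (subset_of_encF hn) hA hC
  · rw [latticeE3_comm₂₃]; exact latticeE3_nonneg_of_subset hμ₀ hμ (subset_of_encF hn) hA hB
  · rw [latticeE3_comm₁₂, latticeE3_comm₂₃]; exact latticeE3_nonneg_of_subset hμ₀ hμ (subset_of_encF hn) hB hA
  · unfold hard3 at hh
    simp only [List.mem_cons, Prod.mk.injEq, List.mem_nil_iff, or_false] at hh
    rcases hh with ⟨hA', hB', hC'⟩ | ⟨hA', hB', hC'⟩ | ⟨hA', hB', hC'⟩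
    · exact hardA_nonneg hμ₀ hA' hB' hC'
    · exact hardB_nonneg hμ₀ hμ hA' hB' hC'
    · exact hardC_nonneg hμ₀ hμ hA' hB' hC'

/-- **Sahi's conjecture `C₃` on `{0,1}³` for every FKG measure.**  For every nonnegative log-supermodular weight `μ` on the cube
`Fin 3 → Bool` and all up-sets `A, B, C`:
`0 ≤ latticeE3 μ A B C = 2Z²·m(A∩B∩C) + m(A)m(B)m(C) − Z·(m(A)m(B∩C) + m(B)m(A∩C) + m(C)m(A∩B))`. [this work] -/
theorem latticeE3_nonneg_cube_three {μ : (Fin 3 → Bool) → ℝ} (hμ₀ : 0 ≤ μ) (hμ : ∀ a b, μ a * μ b ≤ μ (a ⊓ b) * μ (a ⊔ b))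
    {A B C : Finset (Fin 3 → Bool)} (hA : IsUpperSet (A : Set (Fin 3 → Bool))) (hB : IsUpperSet (B : Set (Fin 3 → Bool)))
    (hC : IsUpperSet (C : Set (Fin 3 → Bool))) : 0 ≤ latticeE3 μ A B C := by
  let P : {X : Finset (Fin 3 → Bool) // IsUpperSet (X : Set (Fin 3 → Bool))} →
      {X : Finset (Fin 3 → Bool) // IsUpperSet (X : Set (Fin 3 → Bool))} →
      {X : Finset (Fin 3 → Bool) // IsUpperSet (X : Set (Fin 3 → Bool))} → Prop :=
    fun a b c => 0 ≤ latticeE3 μ a.1 b.1 c.1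
  have key : P ⟨A, hA⟩ ⟨B, hB⟩ ⟨C, hC⟩ := by
    refine forall_of_sorted P (fun a => encF 3 a.1) ?_ ?_ ?_ ⟨A, hA⟩ ⟨B, hB⟩ ⟨C, hC⟩
    · intro a b c habc; simp only [P] at habc ⊢; rwa [latticeE3_comm₁₂]
    · intro a b c habc; simp only [P] at habc ⊢; rwa [latticeE3_comm₂₃]
    · intro a b c hab hbc
      exact latticeE3_nonneg_of_cls3 hμ₀ hμ a.2 b.2 c.2
        (cls3_all _ (encF_mem_upsN a.2) _ (encF_mem_upsN b.2) _ (encF_mem_upsN c.2) hab hbc)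
  exact key

end Summit.CriticalPhenomena.PercolationContinuityZ3.Theorems.SahiC3Cube
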